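import Literature.MathematicalPhysics.KineticTheory.KineticEntropyBalanceFunctional
import HarnessLib

/-!
# Microscale window functionals, Palm entrance functionals and Enskog identification functionals
# of a hard-sphere configuration

Topic `Literature/MathematicalPhysics/KineticTheory` — companion of `EvenCollisionTubeFunctional.lean`,
`CollisionTailMarks.lean` and `KineticEntropyBalanceFunctional.lean` (the vocabularies of the lines of the cruxes
`JParityClosure.EvenStressEnskog` / `LocalSecondLaw`, stmt-AtomisticToContinuum-13079 / 13081).  This file is the
tree home of the vocabulary of the crux line `stationary-microscale-hierarchy-entrance-law` of `EvenStressEnskog`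
(stmt-AtomisticToContinuum-13079), so that its registered stubs can be stated from `Theorems/` files (a `Lines/`
file is never imported).  All bodies are copied verbatim from the line's checked skeleton
(`Summits/…/Cruxes/EvenStressEnskog/Lines/stationary_microscale_hierarchy_entrance_law.lean`, planner
`planner-cruxplan-stmt-AtomisticToContinuum-13079-stationary-microscal-0`), with the skeleton's local copies of
tree notions replaced by the tree notions themselves (`mollEnergy ↦ mollKineticEnergy`, `mollTemp ↦ mollTemperature`,
`mollVelocity ↦ KineticEntropyBalance.uC`, `G3 ↦ Torus.geometry (Fin 3)`; the skeleton's single-particle `preVel` is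
`preVelocity` here, the topic-level `preVel` being the ordered-pair version).

THE OBJECTS.  For `N + 1` hard spheres of diameter `ε` (`= hsDiameter σ N` along a flow `Φ`) on `𝕋³`, one
configuration `z`, a macroscopic space scale `r` (cone kernel `b_r = coneKernel r`, mollified density
`ρ_r = mollDensity r`) and the microscale `ε`:

* topic level: `hsActivity a = a · exp(f_ex(a) + a f_ex′(a))` — the activity of the hard-sphere gas at reduced
  density `a` (`βμ_ex = ∂_a(a f_ex) = f_ex + a f_ex′`; junk-safe, `hsActivity 0 = 0`; honest on the analyticity
  band of the low-density equation of state).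
* sub-namespace `StationaryMicroscale` (the line's names):
  - EULERIAN MICROSCALE WINDOWS (the FREEZE vocabulary): `tupleData ε z x₀ ι` (rescaled data
    `(ε⁻¹ sepVec x_{ιa} x₀, v_{ιa})_a` of an injective tuple seen from a fixed window centre `x₀`), `winObs`
    (`Σ_ι P(data ι)`), `streamObs` (`Σ_ι DP(data ι)[(v_a, 0)_a]`, `ε ×` the free-streaming derivative of `winObs`),
    `preVelocity` / `preConfig` (pre-collisional velocities read off a right-continuous configuration by
    `reflectVel` on the contact pair), `weight` (`χ(s,x₀) g(σ³ρ_r(x₀))`), `densRate` / `weightRate` (the a.e.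
    free-streaming rates of `ρ_r` and of the weight at a fixed centre), `winInt`, `wRateStat`, `streamStat`
    (the streaming functional `∫₀^τ∫ W · streamObs`) and `collJump` (`ε ×` the honest collision sum of the jumps
    of the weighted window integral);
  - PALM ENTRANCE FUNCTIONALS (the ARRIVAL-CHAOS vocabulary): `palmData`, `palmObs`, `palmObsV`, `palmCross`
    (entrance times of `q` into `p`'s microscale `R₁`-sphere), `vacP` (hard-core vacancy indicator at a microscale
    point of `p`'s frame — the Nguyen–Zessin insertion kernel), `palmEntFlux` (the honest entrance-crossing sum)
    and `palmEntPred` (its GNZ ⊗ local-Maxwellian prediction);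
  - IDENTIFICATION FUNCTIONALS: `contactPredM` (the fully Maxwellian Enskog prediction
    `σ³∫₀^τ∫ χ g(η_r) Y(η_r) ρ_r² ⟨Θ Ξ⟩_{M⊗M}` of the collision sum of a mark `Ξ`), `oneBodyStat` / `oneBodyPred`
    (one-body `r`-scale statistic of a test function `F(v, u_r, θ_r)` and its local-Maxwellian prediction).

## References

* H. Spohn, *Large Scale Dynamics of Interacting Particles* (1991), Part I §3.2 (empirical fields tested
  against space–time functions; weak balance laws along the flow), §4.4, Ch. 3.  [Spohn1991]
* X. X. Nguyen, H. Zessin, *Integral and differential characterizations of the Gibbs process*, Math. Nachr. 88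
  (1979) 105–115 (the GNZ equation: insertion kernel `z · 1{vacant}` of a hard-core Gibbs process).  [folklore here:
  only the finite-`N` functional is defined]
* S. Chapman, T. G. Cowling, *The Mathematical Theory of Non-Uniform Gases*, 3rd ed. (1970), Ch. 16 (Enskog's
  collision integral with the contact value `Y`).  [ChapmanCowling1970]
* D. Ruelle, *Statistical Mechanics: Rigorous Results* (1969), §3.4 (activity and excess free energy).  [Ruelle1969]

## Not here

No measurability, integrability or limit statement, and none of the line's named statements
(`ClusterTransportIdentity`, `MicroStationarity`, `ArrivalChaosAt`, `OneBodyMaxwellTested`,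
`ContactMaxwellTested`, …): those, the stubs and their composition are problem-side
(`Summits/AtomisticToContinuum/HydrodynamicLimit/…`).  The tail objects are `speedTailMark` / `velTail` /
`tailEnergy` of `CollisionTailMarks.lean` (not duplicated).
-/

noncomputable section

open scoped BigOperators Classical InnerProductSpace ENNReal
open Set _root_.MeasureTheory
open Literature.Analysis.FluidPDE

namespace Literature.MathematicalPhysics.KineticTheory

variable {N : ℕ}

/-! ## Topic level: the hard-sphere activity -/

/-- Hard-sphere **activity** at reduced density `a`: `z(a) = a · exp(f_ex(a) + a f_ex′(a))`
(`βμ_ex = ∂_a(a f_ex(a)) = f_ex + a f_ex′`, thermal wavelength `1`; `deriv`-junk of `hsExcessFreeEnergy` off its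
differentiability set, junk-safe at `a = 0` where `z(0) = 0`). [cite: Ruelle1969, §3.4] -/
def hsActivity (a : ℝ) : ℝ := a * Real.exp (hsExcessFreeEnergy a + a * deriv hsExcessFreeEnergy a)

/-- `hsActivity 0 = 0` (the empty-ball value is junk-free). [folklore] -/
@[simp]
theorem hsActivity_zero : hsActivity 0 = 0 := by
  simp [hsActivity]

namespace StationaryMicroscale

/-! ## §1 Eulerian microscale window observables (FREEZE vocabulary) -/

/-- Microscale data `(ξ_a, v_a)_a = (ε⁻¹ sepVec x_{ι a} x₀, v_{ι a})_a` of an injective tuple `ι` of particles seen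
from the window centre `x₀` (minimal-image separation on `𝕋³`). [folklore] -/
def tupleData {m : ℕ} (ε : ℝ) (z : Config (N + 1) (Fin 3) T3) (x₀ : T3) (ι : Fin m ↪ Fin (N + 1)) :
    Fin m → V3 × V3 :=
  fun a => (ε⁻¹ • (Torus.geometry (Fin 3)).sepVec (z (ι a)).1 x₀, (z (ι a)).2)

/-- Window tuple observable of level `m`: `Σ_ι P(data ι)` over injective `m`-tuples (for compactly supported `P`
only particles within `ε · radius(supp P)` of `x₀` contribute). [folklore] -/
def winObs {m : ℕ} (ε : ℝ) (P : (Fin m → V3 × V3) → ℝ) (z : Config (N + 1) (Fin 3) T3) (x₀ : T3) : ℝ :=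
  ∑ ι : Fin m ↪ Fin (N + 1), P (tupleData ε z x₀ ι)

/-- Free-streaming derivative observable `Σ_ι DP(data ι)[(v_a, 0)_a]` (`ε ×` the time derivative of `winObs`
between collisions, the window centre being fixed). [folklore] -/
def streamObs {m : ℕ} (ε : ℝ) (P : (Fin m → V3 × V3) → ℝ) (z : Config (N + 1) (Fin 3) T3) (x₀ : T3) : ℝ :=
  ∑ ι : Fin m ↪ Fin (N + 1), (fderiv ℝ P (tupleData ε z x₀ ι)) (fun a => ((tupleData ε z x₀ ι a).2, 0))

/-- Pre-collisional velocity of particle `k` read off a right-continuous configuration: the reflected velocity if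
`k` is in contact with some `l ≠ k` (`‖sepVec x_k x_l‖ = ε`), else `v_k` — the single-particle form of the
ordered-pair `preVel`, with the `pv` convention of the crux `EvenStressEnskog` (`reflectVel (sepVec x_k x_l)`).
On the hard-sphere trajectories of a flow's good set at most one `l` is in contact with `k`. [folklore] -/
def preVelocity (ε : ℝ) (z : Config (N + 1) (Fin 3) T3) (k : Fin (N + 1)) : V3 :=
  (z k).2 + ∑ l : Fin (N + 1),
    (if l ≠ k ∧ ‖(Torus.geometry (Fin 3)).sepVec (z k).1 (z l).1‖ = ε then
      (reflectVel ((Torus.geometry (Fin 3)).sepVec (z k).1 (z l).1) ((z k).2, (z l).2)).1 - (z k).2 else 0)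

/-- The configuration with every velocity replaced by its pre-collisional value `preVelocity`. [folklore] -/
def preConfig (ε : ℝ) (z : Config (N + 1) (Fin 3) T3) : Config (N + 1) (Fin 3) T3 :=
  fun k => ((z k).1, preVelocity ε z k)

/-- The weight `W = χ(s, x₀) · g(σ³ ρ_r(z, x₀))` of the crux `EvenStressEnskog` read at a window centre. [folklore] -/
def weight (σ : ℝ) (χ : ℝ × T3 → ℝ) (g : ℝ → ℝ) (r s : ℝ) (z : Config (N + 1) (Fin 3) T3) (x₀ : T3) : ℝ :=
  χ (s, x₀) * g (σ ^ 3 * mollDensity r z x₀)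

/-- Free-streaming rate of the cone-mollified density at a fixed centre (the a.e. derivative of
`s ↦ ρ_r(freeFlight s z, x₀)` at `s = 0`: `−3/(πr⁴) · ⟪x_k − x₀, v_k⟫ / |x_k − x₀|` per particle in the cone,
weight `(N+1)⁻¹`). [folklore] -/
def densRate (r : ℝ) (z : Config (N + 1) (Fin 3) T3) (x₀ : T3) : ℝ :=
  ((N : ℝ) + 1)⁻¹ * ∑ k : Fin (N + 1),
    (if 0 < Torus.euclidDist (z k).1 x₀ ∧ Torus.euclidDist (z k).1 x₀ < r then
      -(3 / (Real.pi * r ^ 4)) * ⟪(Torus.geometry (Fin 3)).sepVec (z k).1 x₀, (z k).2⟫_ℝ /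
        Torus.euclidDist (z k).1 x₀ else 0)

/-- Free-streaming rate of the weight at a fixed centre: `∂_sχ · g + χ · g′ · σ³ · densRate`. [folklore] -/
def weightRate (σ : ℝ) (χ : ℝ × T3 → ℝ) (g : ℝ → ℝ) (r s : ℝ) (z : Config (N + 1) (Fin 3) T3) (x₀ : T3) : ℝ :=
  deriv (fun s' => χ (s', x₀)) s * g (σ ^ 3 * mollDensity r z x₀) +
    χ (s, x₀) * deriv g (σ ^ 3 * mollDensity r z x₀) * (σ ^ 3 * densRate r z x₀)

/-- Weighted window integral `I(s) = ∫ W(s, x₀) winObs(Φ_s z, x₀) dx₀` along a hard-sphere flow. [folklore] -/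
def winInt (σ : ℝ) (N : ℕ) (Φ : HardSphereFlow (Torus.geometry (Fin 3)) (hsDiameter σ N) (N + 1))
    (χ : ℝ × T3 → ℝ) (g : ℝ → ℝ) (r : ℝ) {m : ℕ} (P : (Fin m → V3 × V3) → ℝ) (s : ℝ)
    (z : Config (N + 1) (Fin 3) T3) : ℝ :=
  ∫ x₀ : T3, weight σ χ g r s (Φ.flow s z) x₀ * winObs (hsDiameter σ N) P (Φ.flow s z) x₀

/-- Time-integrated weight-rate term `∫₀^τ ∫ Ẇ · winObs dx₀ ds`. [folklore] -/
def wRateStat (σ : ℝ) (N : ℕ) (Φ : HardSphereFlow (Torus.geometry (Fin 3)) (hsDiameter σ N) (N + 1)) (τ : ℝ)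
    (χ : ℝ × T3 → ℝ) (g : ℝ → ℝ) (r : ℝ) {m : ℕ} (P : (Fin m → V3 × V3) → ℝ)
    (z : Config (N + 1) (Fin 3) T3) : ℝ :=
  ∫ s in Set.Icc (0 : ℝ) τ, ∫ x₀ : T3,
    weightRate σ χ g r s (Φ.flow s z) x₀ * winObs (hsDiameter σ N) P (Φ.flow s z) x₀

/-- THE STREAMING FUNCTIONAL `∫₀^τ ∫ W · streamObs dx₀ ds` along a hard-sphere flow. [folklore] -/
def streamStat (σ : ℝ) (N : ℕ) (Φ : HardSphereFlow (Torus.geometry (Fin 3)) (hsDiameter σ N) (N + 1)) (τ : ℝ)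
    (χ : ℝ × T3 → ℝ) (g : ℝ → ℝ) (r : ℝ) {m : ℕ} (P : (Fin m → V3 × V3) → ℝ)
    (z : Config (N + 1) (Fin 3) T3) : ℝ :=
  ∫ s in Set.Icc (0 : ℝ) τ, ∫ x₀ : T3,
    weight σ χ g r s (Φ.flow s z) x₀ * streamObs (hsDiameter σ N) P (Φ.flow s z) x₀

/-- THE COLLISION FUNCTIONAL: `ε ×` the honest sum over the collision times in `(0, τ]` of the jumps of the
weighted window integral (internal AND external partners alike; the finsum is the junk `0` for infinitely many
collision times, excluded on the good set of a flow). [folklore] -/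
def collJump (σ : ℝ) (N : ℕ) (Φ : HardSphereFlow (Torus.geometry (Fin 3)) (hsDiameter σ N) (N + 1)) (τ : ℝ)
    (χ : ℝ × T3 → ℝ) (g : ℝ → ℝ) (r : ℝ) {m : ℕ} (P : (Fin m → V3 × V3) → ℝ)
    (z : Config (N + 1) (Fin 3) T3) : ℝ :=
  hsDiameter σ N *
    ∑ᶠ (s : ℝ) (_ : s ∈ collisionTimes (Torus.geometry (Fin 3)) (hsDiameter σ N) (fun s => Φ.flow s z) ∩
        Set.Ioc 0 τ),
      ∫ x₀ : T3, weight σ χ g r s (Φ.flow s z) x₀ *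
        (winObs (hsDiameter σ N) P (Φ.flow s z) x₀ -
          winObs (hsDiameter σ N) P (preConfig (hsDiameter σ N) (Φ.flow s z)) x₀)

/-! ## §2 Palm (particle-centred) entrance functionals (ARRIVAL-CHAOS vocabulary) -/

/-- Microscale data of a tuple seen from PARTICLE `p`: `(ε⁻¹ sepVec x_{ι a} x_p, v_{ι a})_a`. [folklore] -/
def palmData {m : ℕ} (ε : ℝ) (z : Config (N + 1) (Fin 3) T3) (p : Fin (N + 1)) (ι : Fin m ↪ Fin (N + 1)) :
    Fin m → V3 × V3 :=
  fun a => (ε⁻¹ • (Torus.geometry (Fin 3)).sepVec (z (ι a)).1 (z p).1, (z (ι a)).2)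

/-- Entrance observable of an ACTUAL arrival `q` at the sphere of particle `p`: `Σ_ι H(v_p, data_p ι, slot)` over
tuples avoiding `p` and `q`, the arrival slot being `slot`. [folklore] -/
def palmObs {m : ℕ} (ε : ℝ) (H : V3 × (Fin m → V3 × V3) × (V3 × V3) → ℝ) (z : Config (N + 1) (Fin 3) T3)
    (p q : Fin (N + 1)) (slot : V3 × V3) : ℝ :=
  ∑ ι : Fin m ↪ Fin (N + 1),
    (if p ∈ Set.range ι ∨ q ∈ Set.range ι then 0 else H ((z p).2, palmData ε z p ι, slot))

/-- Entrance observable of a VIRTUAL arrival in the slot `slot`: tuples avoiding `p` only. [folklore] -/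
def palmObsV {m : ℕ} (ε : ℝ) (H : V3 × (Fin m → V3 × V3) × (V3 × V3) → ℝ) (z : Config (N + 1) (Fin 3) T3)
    (p : Fin (N + 1)) (slot : V3 × V3) : ℝ :=
  ∑ ι : Fin m ↪ Fin (N + 1), (if p ∈ Set.range ι then 0 else H ((z p).2, palmData ε z p ι, slot))

/-- The ENTRANCE TIMES of particle `q` into the microscale ball of radius `R₁` around particle `p` along a path:
`|ξ_pq| = R₁` with approaching relative velocity. [folklore] -/
def palmCross (ε R₁ : ℝ) (γ : ℝ → Config (N + 1) (Fin 3) T3) (p q : Fin (N + 1)) : Set ℝ :=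
  {s | ‖(ε⁻¹ • (Torus.geometry (Fin 3)).sepVec (γ s q).1 (γ s p).1 : V3)‖ = R₁ ∧
    ⟪(Torus.geometry (Fin 3)).sepVec (γ s q).1 (γ s p).1, (γ s q).2 - (γ s p).2⟫_ℝ < 0}

/-- GNZ hard-core vacancy indicator at the microscale point `y` of the frame of particle `p` (all particles
`k ≠ p`; `p` itself sits at distance `R₁ > 1` from an entrance point): the insertion kernel `1{y vacant}` of the
Nguyen–Zessin equation of a hard-core process, at finite `N`. [folklore] -/
def vacP (ε : ℝ) (z : Config (N + 1) (Fin 3) T3) (p : Fin (N + 1)) (y : V3) : ℝ :=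
  ∏ k : Fin (N + 1), (if k ≠ p ∧ ‖ε⁻¹ • (Torus.geometry (Fin 3)).sepVec (z k).1 (z p).1 - y‖ < 1 then 0 else 1)

/-- THE PALM ENTRANCE FLUX of a test function `H(v_p; interior tuple; arrival)`: `ε/(N+1) ×` the honest sum, over
ordered pairs `p ≠ q` and the entrance times of `q` into `p`'s `R₁`-sphere in `(0, τ]`, of
`χ(s, x_p) g(σ³ρ_r(x_p)) · palmObs`. [folklore] -/
def palmEntFlux (σ : ℝ) (N : ℕ) (Φ : HardSphereFlow (Torus.geometry (Fin 3)) (hsDiameter σ N) (N + 1))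
    (τ : ℝ) (χ : ℝ × T3 → ℝ) (g : ℝ → ℝ) (r R₁ : ℝ) {m : ℕ} (H : V3 × (Fin m → V3 × V3) × (V3 × V3) → ℝ)
    (z : Config (N + 1) (Fin 3) T3) : ℝ :=
  hsDiameter σ N / (N + 1 : ℝ) * ∑ p : Fin (N + 1), ∑ q : Fin (N + 1),
    (if p ≠ q then
      ∑ᶠ (s : ℝ) (_ : s ∈ palmCross (hsDiameter σ N) R₁ (fun s => Φ.flow s z) p q ∩ Set.Ioc 0 τ),
        weight σ χ g r s (Φ.flow s z) ((Φ.flow s z) p).1 *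
          palmObs (hsDiameter σ N) H (Φ.flow s z) p q
            ((hsDiameter σ N)⁻¹ • (Torus.geometry (Fin 3)).sepVec ((Φ.flow s z) q).1 ((Φ.flow s z) p).1,
              ((Φ.flow s z) q).2)
    else 0)

/-- THE ARRIVAL-CHAOS PREDICTION of the Palm entrance flux: arrivals at `p`'s `R₁`-sphere form, given everything
else, the GNZ ⊗ local-Maxwellian stream `z(η_r) · vac · M_{1, θ_r, u_r}(w) · ((w − v_p)·n)₋ R₁² dn dw` per unit
microscale time, the local parameters (`hsActivity`, `mollTemperature`, `KineticEntropyBalance.uC`) being read at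
`x_p` on the `r`-ball. [folklore] -/
def palmEntPred (σ : ℝ) (N : ℕ) (Φ : HardSphereFlow (Torus.geometry (Fin 3)) (hsDiameter σ N) (N + 1))
    (τ : ℝ) (χ : ℝ × T3 → ℝ) (g : ℝ → ℝ) (r R₁ : ℝ) {m : ℕ} (H : V3 × (Fin m → V3 × V3) × (V3 × V3) → ℝ)
    (z : Config (N + 1) (Fin 3) T3) : ℝ :=
  R₁ ^ 2 * ∫ s in Set.Icc (0 : ℝ) τ, ((N : ℝ) + 1)⁻¹ * ∑ p : Fin (N + 1),
    weight σ χ g r s (Φ.flow s z) ((Φ.flow s z) p).1 *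
        hsActivity (σ ^ 3 * mollDensity r (Φ.flow s z) ((Φ.flow s z) p).1) *
      ∫ ω : Metric.sphere (0 : V3) 1, (∫ w : V3,
        max (-⟪w - ((Φ.flow s z) p).2, (ω : V3)⟫_ℝ) 0 * vacP (hsDiameter σ N) (Φ.flow s z) p (R₁ • (ω : V3)) *
          localMaxwellian 1 (mollTemperature r (Φ.flow s z) ((Φ.flow s z) p).1)
            (KineticEntropyBalance.uC r (Φ.flow s z) ((Φ.flow s z) p).1) w *
          palmObsV (hsDiameter σ N) H (Φ.flow s z) p (R₁ • (ω : V3), w))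
      ∂sphereMeasure

/-! ## §3 Prediction functionals of the identification step -/

/-- Fully Maxwellian Enskog prediction of the collision sum of a mark `Ξ`:
`σ³ ∫₀^τ ∫ χ g(η_r) Y(η_r) ρ_r² ⟨Θ Ξ⟩_{M ⊗ M} dx ds` with `M = M_{1, θ_r(x), u_r(x)}`, `Y = contactValue`,
`Θ = sphereMark` (Enskog's collision integral at a local Maxwellian with the thermodynamic contact value).
[cite: ChapmanCowling1970, Ch. 16] -/
def contactPredM (σ : ℝ) (N : ℕ) (Φ : HardSphereFlow (Torus.geometry (Fin 3)) (hsDiameter σ N) (N + 1))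
    (τ : ℝ) (χ : ℝ × T3 → ℝ) (g : ℝ → ℝ) (Ξ : V3 × V3 × V3 → ℝ) (r : ℝ) (z : Config (N + 1) (Fin 3) T3) : ℝ :=
  σ ^ 3 * ∫ s in Set.Icc (0 : ℝ) τ, ∫ x : T3,
    χ (s, x) * g (σ ^ 3 * mollDensity r (Φ.flow s z) x) * contactValue (σ ^ 3 * mollDensity r (Φ.flow s z) x) *
      mollDensity r (Φ.flow s z) x ^ 2 *
      ∫ v : V3, ∫ w : V3, sphereMark Ξ v w *
        localMaxwellian 1 (mollTemperature r (Φ.flow s z) x) (KineticEntropyBalance.uC r (Φ.flow s z) x) v *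
        localMaxwellian 1 (mollTemperature r (Φ.flow s z) x) (KineticEntropyBalance.uC r (Φ.flow s z) x) w

/-- One-body `r`-scale statistic of a test function `F(v, u, θ)` with density weight `k`:
`∫₀^τ ∫ χ k(η_r(x)) ∫ b_r(y, x) F(v, u_r(x), θ_r(x)) dμ_s(y, v) dx ds`. [folklore] -/
def oneBodyStat (σ : ℝ) (N : ℕ) (Φ : HardSphereFlow (Torus.geometry (Fin 3)) (hsDiameter σ N) (N + 1))
    (τ : ℝ) (χ : ℝ × T3 → ℝ) (k : ℝ → ℝ) (F : V3 × V3 × ℝ → ℝ) (r : ℝ) (z : Config (N + 1) (Fin 3) T3) : ℝ :=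
  ∫ s in Set.Icc (0 : ℝ) τ, ∫ x : T3,
    χ (s, x) * k (σ ^ 3 * mollDensity r (Φ.flow s z) x) *
      ∫ q, coneKernel r q.1 x *
          F (q.2, KineticEntropyBalance.uC r (Φ.flow s z) x, mollTemperature r (Φ.flow s z) x)
        ∂(empiricalMeasure (Φ.flow s z))

/-- Its local-Maxwellian prediction `∫₀^τ ∫ χ k(η_r) ρ_r ⟨F(·, u_r, θ_r)⟩_{M_{1,θ_r,u_r}} dx ds`. [folklore] -/
def oneBodyPred (σ : ℝ) (N : ℕ) (Φ : HardSphereFlow (Torus.geometry (Fin 3)) (hsDiameter σ N) (N + 1))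
    (τ : ℝ) (χ : ℝ × T3 → ℝ) (k : ℝ → ℝ) (F : V3 × V3 × ℝ → ℝ) (r : ℝ) (z : Config (N + 1) (Fin 3) T3) : ℝ :=
  ∫ s in Set.Icc (0 : ℝ) τ, ∫ x : T3,
    χ (s, x) * k (σ ^ 3 * mollDensity r (Φ.flow s z) x) * mollDensity r (Φ.flow s z) x *
      ∫ v : V3, F (v, KineticEntropyBalance.uC r (Φ.flow s z) x, mollTemperature r (Φ.flow s z) x) *
        localMaxwellian 1 (mollTemperature r (Φ.flow s z) x) (KineticEntropyBalance.uC r (Φ.flow s z) x) v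

/-! ## API (elementary unfoldings) -/

/-- `winObs` of the zero test function vanishes. [folklore] -/
@[simp]
theorem winObs_zero {m : ℕ} (ε : ℝ) (z : Config (N + 1) (Fin 3) T3) (x₀ : T3) :
    winObs ε (fun _ : Fin m → V3 × V3 => (0 : ℝ)) z x₀ = 0 := by
  simp [winObs]

/-- Positions are unchanged by `preConfig`. [folklore] -/
@[simp]
theorem preConfig_apply_fst (ε : ℝ) (z : Config (N + 1) (Fin 3) T3) (k : Fin (N + 1)) :
    (preConfig ε z k).1 = (z k).1 := rfl

/-- Velocities of `preConfig` are the pre-collisional velocities. [folklore] -/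
@[simp]
theorem preConfig_apply_snd (ε : ℝ) (z : Config (N + 1) (Fin 3) T3) (k : Fin (N + 1)) :
    (preConfig ε z k).2 = preVelocity ε z k := rfl

/-- A particle in contact with nobody keeps its velocity under `preVelocity`. [folklore] -/
theorem preVelocity_eq_of_forall_ne {ε : ℝ} {z : Config (N + 1) (Fin 3) T3} {k : Fin (N + 1)}
    (h : ∀ l, l ≠ k → ‖(Torus.geometry (Fin 3)).sepVec (z k).1 (z l).1‖ ≠ ε) :
    preVelocity ε z k = (z k).2 := by
  unfold preVelocity
  rw [Finset.sum_eq_zero, add_zero]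
  intro l _
  by_cases hl : l ≠ k ∧ ‖(Torus.geometry (Fin 3)).sepVec (z k).1 (z l).1‖ = ε
  · exact absurd hl.2 (h l hl.1)
  · rw [if_neg hl]

/-- The weight unfolds. [folklore] -/
theorem weight_apply (σ : ℝ) (χ : ℝ × T3 → ℝ) (g : ℝ → ℝ) (r s : ℝ) (z : Config (N + 1) (Fin 3) T3) (x₀ : T3) :
    weight σ χ g r s z x₀ = χ (s, x₀) * g (σ ^ 3 * mollDensity r z x₀) := rfl

end StationaryMicroscale

end Literature.MathematicalPhysics.KineticTheory

end
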